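import Summits.Ventures.LatticeQCDFlow.Exactness.IMHAnyStartPathSplit
import HarnessLib

/-!
# Every start: the coverage guarantee after `b` discarded updates, and THE COLD CONFIGURATION IS THE WORST START

HONEST FRAMING: exact (Metropolis-corrected) sampling algorithms for lattice gauge theory;
figures of merit are autocorrelation/cost numbers at stated couplings and volumes; no
continuum-physics claim.

Venture `LatticeQCDFlow` (cell pub-lqcd), topic `Exactness`; FANOUT row 30 (lean-1, GEN-34).  NEW WORK of the
cell, general state space.  Consequences of the any-start path law `P_{μ₀} ∘ θ_b⁻¹ = (1 − r^b)·P_π + r^b·P_{μ₀R^b}`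
(`Exactness/IMHAnyStartPathSplit`, this generation; `K = indepMH q w`, `x₀` a mode of the normalised weight `w`,
`r = 1 − 1/w(x₀)`, path space = Mathlib's `Kernel.trajMeasure`):

* §1 **`imh_chain_coverage_anyStart`** — THE COVERAGE GUARANTEE: if an equilibrium procedure succeeds with
  probability `P_π(E) ≥ 1 − α` (a calibrated error bar, a passed test — any measurable set of runs), then from EVERY
  start `μ₀`, applied to the stream after `b` discarded updates, it succeeds with probability
  `P_{μ₀}(X_{b+·} ∈ E) ≥ (1 − r^b)·(1 − α)`; additive forms **`imh_chain_coverage_anyStart'`** (`≥ 1 − α − r^b`) and,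
  with the burn-in rule `log(1/ε) ≤ b/w(x₀)`, **`imh_chain_coverage_anyStart_of_log_le`** (`≥ 1 − α − ε`):
  DISCARDING `w(x₀)·log(1/ε)` UPDATES MAKES EVERY EQUILIBRIUM-CALIBRATED ERROR BAR VALID FROM EVERY START UP TO `ε`.
* §2 **`imh_chain_shift_anyStart_abs_le_cold`** — THE COLD CONFIGURATION IS THE WORST START (atom-free proposal,
  `q{x₀} = 0`): for every start `μ₀`, every measurable set of runs `E` and every `b`, the deviation
  `|P_{μ₀}(X_{b+·} ∈ E) − P_π(E)|` is at most the cold start's deviation at its witness event `{X_0 = x₀}`, which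
  GEN-33 computed to be EXACTLY `r^b` (`IMHColdStartPathMixture.imh_chain_shift_atMode_sub_stationary`): the
  supremum over starts and events of the path-space deviation after `b` discarded updates is `r^b`, attained by the
  cold start — no initial law is harder to forget than the cold configuration.
* §3 **`imh_chain_shiftInvariant_anyStart`** — SHIFT-INVARIANT EVENTS FROM EVERY START: for every measurable set of
  runs `E` with `θ_b⁻¹E = E` for some `b ≥ 1`, `P_{μ₀}(E) = P_π(E)` EXACTLY for every initial law (GEN-33's
  `IMHColdStartInvariantEvents` was the modal start; here `|P_{μ₀}(E) − P_π(E)| ≤ r^{kb}` for every `k`).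

Reading (gauge files `Scaling/AutoregressiveGauge…AnyStart`): an exact gauge sampler started anywhere and read
after `b` discarded configurations passes every equilibrium-calibrated check with probability at least
`(1 − (1 − A)^b)` × the calibrated one, and is never further from the equilibrium run than the cold start is.
NOT CLAIMED: that a particular non-modal start is strictly better than the cold one (only "never worse"); with an
atom of the proposal at the mode the supremum in §2 is not asserted.

No `sorry`, no new definitions, nothing cited as a fact; general measurable space (measurable singletons in §2).
-/

noncomputable section

namespace Summit.Ventures.LatticeQCDFlow.Exactness

open MeasureTheory ProbabilityTheory Function
open scoped ENNReal
open Summit.Ventures.LatticeQCDFlow.Scoring Literature.Probability.MarkovChains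

variable {Ω : Type*} [MeasurableSpace Ω] {q : Measure Ω} [IsProbabilityMeasure q] {w : Ω → ℝ}

/-! ## §1 The coverage guarantee from every start -/

/-- **THE COVERAGE GUARANTEE FROM EVERY START**: if `P_π(E) ≥ 1 − α` then
`P_{μ₀}(X_{b+·} ∈ E) ≥ (1 − r^b)·(1 − α)` for every start `μ₀` — an equilibrium-calibrated error bar ∕ test applied
to the stream after `b` discarded updates keeps the fraction `1 − r^b` of its calibration, whatever the start. [ours] -/
theorem imh_chain_coverage_anyStart [Fact (Measurable w)] (hw0 : ∀ y, 0 < w y) {x₀ : Ω}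
    (hmax : ∀ y, w y ≤ w x₀) [IsProbabilityMeasure (q.withDensity fun y => ENNReal.ofReal (w y))]
    (μ₀ : Measure Ω) [IsProbabilityMeasure μ₀] {E : Set (ℕ → Ω)} (hE : MeasurableSet E) (b : ℕ) {α : ℝ}
    (hcal : 1 - α ≤ (Kernel.trajMeasure (X := fun _ : ℕ => Ω) (q.withDensity fun y => ENNReal.ofReal (w y))
            (fun n : ℕ => (indepMH q w).comap (fun h : (i : ↥(Finset.Iic n)) → Ω => h ⟨n, Finset.mem_Iic.2 le_rfl⟩)
              (measurable_pi_apply _))).real E) :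
    (1 - (1 - (w x₀)⁻¹) ^ b) * (1 - α) ≤
      (Kernel.trajMeasure (X := fun _ : ℕ => Ω) μ₀
        (fun n : ℕ => (indepMH q w).comap (fun h : (i : ↥(Finset.Iic n)) → Ω => h ⟨n, Finset.mem_Iic.2 le_rfl⟩)
          (measurable_pi_apply _))).real ((fun (x : ℕ → Ω) (n : ℕ) => x (b + n)) ⁻¹' E) := by
  refine le_trans ?_ (imh_chain_shift_real_anyStart_ge (q := q) hw0 hmax μ₀ hE b)
  have hW : 1 ≤ w x₀ := one_le_of_mode (q := q) hmax
  have hr0 : 0 ≤ 1 - (w x₀)⁻¹ := sub_nonneg.2 (inv_le_one_of_one_le₀ hW)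
  have hr1 : 1 - (w x₀)⁻¹ ≤ 1 := sub_le_self _ (inv_nonneg.mpr (hw0 x₀).le)
  exact mul_le_mul_of_nonneg_left hcal (sub_nonneg.2 (pow_le_one₀ hr0 hr1))

/-- **… in the additive form `≥ 1 − α − r^b`** (`α ≥ 0`). [ours] -/
theorem imh_chain_coverage_anyStart' [Fact (Measurable w)] (hw0 : ∀ y, 0 < w y) {x₀ : Ω}
    (hmax : ∀ y, w y ≤ w x₀) [IsProbabilityMeasure (q.withDensity fun y => ENNReal.ofReal (w y))]
    (μ₀ : Measure Ω) [IsProbabilityMeasure μ₀] {E : Set (ℕ → Ω)} (hE : MeasurableSet E) (b : ℕ) {α : ℝ}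
    (hα : 0 ≤ α)
    (hcal : 1 - α ≤ (Kernel.trajMeasure (X := fun _ : ℕ => Ω) (q.withDensity fun y => ENNReal.ofReal (w y))
            (fun n : ℕ => (indepMH q w).comap (fun h : (i : ↥(Finset.Iic n)) → Ω => h ⟨n, Finset.mem_Iic.2 le_rfl⟩)
              (measurable_pi_apply _))).real E) :
    1 - α - (1 - (w x₀)⁻¹) ^ b ≤
      (Kernel.trajMeasure (X := fun _ : ℕ => Ω) μ₀
        (fun n : ℕ => (indepMH q w).comap (fun h : (i : ↥(Finset.Iic n)) → Ω => h ⟨n, Finset.mem_Iic.2 le_rfl⟩)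
          (measurable_pi_apply _))).real ((fun (x : ℕ → Ω) (n : ℕ) => x (b + n)) ⁻¹' E) := by
  refine le_trans ?_ (imh_chain_coverage_anyStart (q := q) hw0 hmax μ₀ hE b hcal)
  have hW : 1 ≤ w x₀ := one_le_of_mode (q := q) hmax
  have hr0 : 0 ≤ (1 - (w x₀)⁻¹) ^ b := pow_nonneg (sub_nonneg.2 (inv_le_one_of_one_le₀ hW)) b
  nlinarith

/-- **… and with the burn-in rule**: `log(1/ε) ≤ b/w(x₀)` ⇒ `P_{μ₀}(X_{b+·} ∈ E) ≥ 1 − α − ε`. [ours] -/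
theorem imh_chain_coverage_anyStart_of_log_le [Fact (Measurable w)] (hw0 : ∀ y, 0 < w y) {x₀ : Ω}
    (hmax : ∀ y, w y ≤ w x₀) [IsProbabilityMeasure (q.withDensity fun y => ENNReal.ofReal (w y))]
    (μ₀ : Measure Ω) [IsProbabilityMeasure μ₀] {E : Set (ℕ → Ω)} (hE : MeasurableSet E) {b : ℕ} {α ε : ℝ}
    (hα : 0 ≤ α) (hε : 0 < ε) (hb : Real.log (1 / ε) ≤ b * (w x₀)⁻¹)
    (hcal : 1 - α ≤ (Kernel.trajMeasure (X := fun _ : ℕ => Ω) (q.withDensity fun y => ENNReal.ofReal (w y))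
            (fun n : ℕ => (indepMH q w).comap (fun h : (i : ↥(Finset.Iic n)) → Ω => h ⟨n, Finset.mem_Iic.2 le_rfl⟩)
              (measurable_pi_apply _))).real E) :
    1 - α - ε ≤
      (Kernel.trajMeasure (X := fun _ : ℕ => Ω) μ₀
        (fun n : ℕ => (indepMH q w).comap (fun h : (i : ↥(Finset.Iic n)) → Ω => h ⟨n, Finset.mem_Iic.2 le_rfl⟩)
          (measurable_pi_apply _))).real ((fun (x : ℕ → Ω) (n : ℕ) => x (b + n)) ⁻¹' E) := by
  have h := imh_chain_coverage_anyStart' (q := q) hw0 hmax μ₀ hE b hα hcal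
  have hr := pow_mode_le_of_log_le (q := q) hmax hε hb
  linarith

/-! ## §2 The cold configuration is the worst start -/

variable [MeasurableSingletonClass Ω]

/-- **THE COLD CONFIGURATION IS THE WORST START** (atom-free proposal, `q{x₀} = 0`): for every start `μ₀`, every
measurable set of runs `E` and every `b`, the deviation `|P_{μ₀}(X_{b+·} ∈ E) − P_π(E)|` is at most the cold start's
deviation at its witness event `{X_0 = x₀}`, which GEN-33 computed to be exactly `r^b`
(`imh_chain_shift_atMode_sub_stationary`): `sup_{μ₀, E} |P_{μ₀} ∘ θ_b⁻¹(E) − P_π(E)| = r^b`, attained at the mode.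
[ours] -/
theorem imh_chain_shift_anyStart_abs_le_cold [Fact (Measurable w)] (hw0 : ∀ y, 0 < w y) {x₀ : Ω}
    (hmax : ∀ y, w y ≤ w x₀) (hqx : q {x₀} = 0)
    [IsProbabilityMeasure (q.withDensity fun y => ENNReal.ofReal (w y))]
    (μ₀ : Measure Ω) [IsProbabilityMeasure μ₀] {E : Set (ℕ → Ω)} (hE : MeasurableSet E) (b : ℕ) :
    |(Kernel.trajMeasure (X := fun _ : ℕ => Ω) μ₀
        (fun n : ℕ => (indepMH q w).comap (fun h : (i : ↥(Finset.Iic n)) → Ω => h ⟨n, Finset.mem_Iic.2 le_rfl⟩)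
          (measurable_pi_apply _))).real ((fun (x : ℕ → Ω) (n : ℕ) => x (b + n)) ⁻¹' E) -
      (Kernel.trajMeasure (X := fun _ : ℕ => Ω) (q.withDensity fun y => ENNReal.ofReal (w y))
        (fun n : ℕ => (indepMH q w).comap (fun h : (i : ↥(Finset.Iic n)) → Ω => h ⟨n, Finset.mem_Iic.2 le_rfl⟩)
          (measurable_pi_apply _))).real E| ≤
      (Kernel.trajMeasure (X := fun _ : ℕ => Ω) (Measure.dirac x₀)
          (fun n : ℕ => (indepMH q w).comap (fun h : (i : ↥(Finset.Iic n)) → Ω => h ⟨n, Finset.mem_Iic.2 le_rfl⟩)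
            (measurable_pi_apply _))).real
          ((fun (x : ℕ → Ω) (n : ℕ) => x (b + n)) ⁻¹' {x : ℕ → Ω | x 0 ∈ ({x₀} : Set Ω)}) -
        (Kernel.trajMeasure (X := fun _ : ℕ => Ω) (q.withDensity fun y => ENNReal.ofReal (w y))
          (fun n : ℕ => (indepMH q w).comap (fun h : (i : ↥(Finset.Iic n)) → Ω => h ⟨n, Finset.mem_Iic.2 le_rfl⟩)
            (measurable_pi_apply _))).real {x : ℕ → Ω | x 0 ∈ ({x₀} : Set Ω)} := by
  rw [imh_chain_shift_atMode_sub_stationary hw0 hmax hqx b]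
  exact imh_chain_shift_real_anyStart_abs_le' (q := q) hw0 hmax μ₀ hE b


/-! ## §3 Shift-invariant events have their equilibrium probability from every start -/

omit [MeasurableSpace Ω] [MeasurableSingletonClass Ω] in
/-- Iterating the shift: `θ_b^[k] = θ_{kb}` as maps on paths. [ours, bookkeeping] -/
theorem shift_iterate_eq (b k : ℕ) :
    (fun (x : ℕ → Ω) (n : ℕ) => x (b + n))^[k] = fun (x : ℕ → Ω) (n : ℕ) => x (k * b + n) := by
  induction k with
  | zero => funext x n; simp
  | succ k ih =>
    rw [Function.iterate_succ, ih]
    funext x n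
    simp only [Function.comp_apply]
    congr 1
    ring

omit [MeasurableSpace Ω] [MeasurableSingletonClass Ω] in
/-- A `θ_b`-invariant set of runs is `θ_{kb}`-invariant for every `k`. [ours, bookkeeping] -/
theorem preimage_shift_mul_eq_of_invariant {E : Set (ℕ → Ω)} {b : ℕ}
    (hinv : (fun (x : ℕ → Ω) (n : ℕ) => x (b + n)) ⁻¹' E = E) (k : ℕ) :
    (fun (x : ℕ → Ω) (n : ℕ) => x (k * b + n)) ⁻¹' E = E := by
  rw [← shift_iterate_eq b k]
  induction k with
  | zero => simp
  | succ k ih =>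
    rw [Function.iterate_succ, Set.preimage_comp, ih, hinv]

omit [MeasurableSingletonClass Ω] in
/-- **SHIFT-INVARIANT EVENTS FROM EVERY START**: `θ_b⁻¹E = E` with `b ≥ 1` ⇒ `P_{μ₀}(E) = P_π(E)` for every
initial law `μ₀` (the deviation is at most `r^{kb}` for every `k`, and `r < 1`). [ours] -/
theorem imh_chain_shiftInvariant_anyStart [Fact (Measurable w)] (hw0 : ∀ y, 0 < w y) {x₀ : Ω}
    (hmax : ∀ y, w y ≤ w x₀) [IsProbabilityMeasure (q.withDensity fun y => ENNReal.ofReal (w y))]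
    (μ₀ : Measure Ω) [IsProbabilityMeasure μ₀] {E : Set (ℕ → Ω)} (hE : MeasurableSet E) {b : ℕ} (hb : 1 ≤ b)
    (hinv : (fun (x : ℕ → Ω) (n : ℕ) => x (b + n)) ⁻¹' E = E) :
    (Kernel.trajMeasure (X := fun _ : ℕ => Ω) μ₀
        (fun n : ℕ => (indepMH q w).comap (fun h : (i : ↥(Finset.Iic n)) → Ω => h ⟨n, Finset.mem_Iic.2 le_rfl⟩)
          (measurable_pi_apply _))).real E =
      (Kernel.trajMeasure (X := fun _ : ℕ => Ω) (q.withDensity fun y => ENNReal.ofReal (w y))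
        (fun n : ℕ => (indepMH q w).comap (fun h : (i : ↥(Finset.Iic n)) → Ω => h ⟨n, Finset.mem_Iic.2 le_rfl⟩)
          (measurable_pi_apply _))).real E := by
  have hW : 1 ≤ w x₀ := one_le_of_mode (q := q) hmax
  have hr0 : 0 ≤ 1 - (w x₀)⁻¹ := sub_nonneg.2 (inv_le_one_of_one_le₀ hW)
  have hrlt : 1 - (w x₀)⁻¹ < 1 := sub_lt_self _ (inv_pos.mpr (hw0 x₀))
  -- the deviation is bounded by `r^{kb}` for every `k`
  have hk : ∀ k : ℕ, |(Kernel.trajMeasure (X := fun _ : ℕ => Ω) μ₀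
        (fun n : ℕ => (indepMH q w).comap (fun h : (i : ↥(Finset.Iic n)) → Ω => h ⟨n, Finset.mem_Iic.2 le_rfl⟩)
          (measurable_pi_apply _))).real E -
      (Kernel.trajMeasure (X := fun _ : ℕ => Ω) (q.withDensity fun y => ENNReal.ofReal (w y))
        (fun n : ℕ => (indepMH q w).comap (fun h : (i : ↥(Finset.Iic n)) → Ω => h ⟨n, Finset.mem_Iic.2 le_rfl⟩)
          (measurable_pi_apply _))).real E| ≤ ((1 - (w x₀)⁻¹) ^ b) ^ k := by
    intro k
    have h := imh_chain_shift_real_anyStart_abs_le' (q := q) hw0 hmax μ₀ hE (k * b)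
    rw [preimage_shift_mul_eq_of_invariant hinv k] at h
    rwa [← pow_mul, mul_comm]
  have hlim : Filter.Tendsto (fun k : ℕ => ((1 - (w x₀)⁻¹) ^ b) ^ k) Filter.atTop (nhds 0) :=
    tendsto_pow_atTop_nhds_zero_of_lt_one (pow_nonneg hr0 b) (pow_lt_one₀ hr0 hrlt (by omega))
  have h0 : |(Kernel.trajMeasure (X := fun _ : ℕ => Ω) μ₀
        (fun n : ℕ => (indepMH q w).comap (fun h : (i : ↥(Finset.Iic n)) → Ω => h ⟨n, Finset.mem_Iic.2 le_rfl⟩)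
          (measurable_pi_apply _))).real E -
      (Kernel.trajMeasure (X := fun _ : ℕ => Ω) (q.withDensity fun y => ENNReal.ofReal (w y))
        (fun n : ℕ => (indepMH q w).comap (fun h : (i : ↥(Finset.Iic n)) → Ω => h ⟨n, Finset.mem_Iic.2 le_rfl⟩)
          (measurable_pi_apply _))).real E| ≤ 0 :=
    ge_of_tendsto' hlim hk
  have hz := le_antisymm h0 (abs_nonneg _)
  rw [abs_eq_zero, sub_eq_zero] at hz
  exact hz

end Summit.Ventures.LatticeQCDFlow.Exactness

end
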